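import Literature.AlgebraicGeometry.Resolution.PthRootGeneratorsValuation
import HarnessLib

/-!
# The integral closure of a local domain in a degree-`p` extension generated by a `p`-th root is
# local

Topic: `Literature/AlgebraicGeometry/Resolution` (Kummer bookkeeping for purely inseparable
extensions of degree `p` in characteristic `p`). Let `O` be an integrally closed local domain with
fraction field `K` of characteristic `p`, `L | K` an extension of degree `p`, and `y ∈ L ∖ K` with
`y^p ∈ K` (so `L = K(y)` is purely inseparable of degree `p`). Then `integralClosure O L` is a
LOCAL ring: every `b ∈ L` has `b^p ∈ K` (expand `b` on the basis `1, y, …, y^{p-1}` and apply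
Frobenius, `exists_eq_sum_smul_pow_and_pow_eq`); if `b` is integral over `O` so is `b^p ∈ K`,
whence `b^p ∈ O`; and then any two maximal ideals `𝔫, 𝔫'` of the integral extension
`integralClosure O L ⊇ O` coincide (`x ∈ 𝔫 ⇒ x^p ∈ 𝔫 ∩ O = 𝔪_O = 𝔫' ∩ O ⇒ x ∈ 𝔫'`).
Everything is PROVED:

* `pow_char_mem_range_of_pth_root` — `b^p ∈ K` for all `b ∈ L`;
* `pow_char_mem_range_of_isIntegral` — `b^p ∈ O` for `b ∈ L` integral over `O`;
* `isLocalRing_integralClosure_of_pth_root` — the theorem.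

Used by the exceptionalisation game of `CleanModelsSuffice` (route `RadicialJung`): the
normalisation-singular locus `{w | integralClosure 𝒪_{V,w} L not regular}` is closed as soon as all
these integral closures are local (`isClosed_setOf_not_isRegularLocalRing_integralClosure`).

## Sources

Folklore (a purely inseparable extension is "geometrically unibranch": the normalisation is a
homeomorphism; cf. The Stacks Project, Tag 0BRA, and Tag 09E6 for degree-`p` generators). No
printed source is followed; everything is proved from Mathlib and `PthRootGeneratorsValuation.lean`.
[StacksProject]
-/

noncomputable section

open IsLocalRing

namespace Literature.AlgebraicGeometry.Resolution

variable {O K L : Type*} [CommRing O] [Field K] [Algebra O K] [Field L] [Algebra K L]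
  [Algebra O L] [IsScalarTower O K L]

/-- If `[L : K] = p = char K` and `y ∈ L ∖ K` has `y^p ∈ K`, then every `b ∈ L` has `b^p ∈ K`
(expand on the basis of powers of `y` and apply Frobenius). [folklore] -/
theorem pow_char_mem_range_of_pth_root {p : ℕ} (hp : p.Prime) [CharP K p]
    (hdeg : Module.finrank K L = p) (g : K) (y : L) (hy : y ∉ Set.range (algebraMap K L))
    (hyp : y ^ p = algebraMap K L g) (b : L) : ∃ c : K, b ^ p = algebraMap K L c := by
  obtain ⟨κ, -, hb⟩ := exists_eq_sum_smul_pow_and_pow_eq (A := K) hp hdeg g y hy hyp b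
  exact ⟨_, hb⟩

variable [IsFractionRing O K] [IsIntegrallyClosed O]

/-- With `O` integrally closed in `K = Frac O`: an element `b ∈ L` integral over `O` has
`b^p ∈ O`. [folklore] -/
theorem pow_char_mem_range_of_isIntegral {p : ℕ} (hp : p.Prime) [CharP K p]
    (hdeg : Module.finrank K L = p) (g : K) (y : L) (hy : y ∉ Set.range (algebraMap K L))
    (hyp : y ^ p = algebraMap K L g) {b : L} (hb : IsIntegral O b) :
    ∃ c : O, b ^ p = algebraMap O L c := by
  obtain ⟨c, hc⟩ := pow_char_mem_range_of_pth_root hp hdeg g y hy hyp b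
  have hcint : IsIntegral O (algebraMap K L c) := hc ▸ hb.pow p
  have hcint' : IsIntegral O c :=
    (isIntegral_algHom_iff (IsScalarTower.toAlgHom O K L) (algebraMap K L).injective).mp hcint
  obtain ⟨o, ho⟩ := (IsIntegrallyClosed.isIntegral_iff (R := O) (K := K)).mp hcint'
  exact ⟨o, by rw [hc, ← ho, ← IsScalarTower.algebraMap_apply]⟩

variable [IsLocalRing O]

/-- **The integral closure of an integrally closed local domain `O` (fraction field `K` of
characteristic `p`) in a degree-`p` extension `L = K(y)`, `y^p ∈ K`, `y ∉ K`, is a local ring.**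
All `p`-th powers of `integralClosure O L` lie in `O`, so for maximal ideals `𝔫, 𝔫'` (both over
`𝔪_O`, the extension being integral): `x ∈ 𝔫 ⇒ x^p ∈ 𝔪_O ⊆ 𝔫' ⇒ x ∈ 𝔫'`. [folklore] -/
theorem isLocalRing_integralClosure_of_pth_root {p : ℕ} (hp : p.Prime) [CharP K p]
    (hdeg : Module.finrank K L = p) (g : K) (y : L) (hy : y ∉ Set.range (algebraMap K L))
    (hyp : y ^ p = algebraMap K L g) : IsLocalRing (integralClosure O L) := by
  -- adapted from `stub_kummerOrderStructure` (locality of the Kummer order), Summits tree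
  let C := integralClosure O L
  haveI : Algebra.IsIntegral O C := inferInstanceAs (Algebra.IsIntegral O (integralClosure O L))
  have key : ∀ I J : Ideal C, I.IsMaximal → J.IsMaximal → I ≤ J := by
    intro I J hI hJ x hx
    obtain ⟨c, hc⟩ := pow_char_mem_range_of_isIntegral hp hdeg g y hy hyp x.2
    have hxp : x ^ p = algebraMap O C c := Subtype.ext (by simpa using hc)
    have hcI : c ∈ I.comap (algebraMap O C) := by
      rw [Ideal.mem_comap, ← hxp]
      exact I.pow_mem_of_mem hx p hp.pos
    have hIc : I.comap (algebraMap O C) ≤ maximalIdeal O :=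
      IsLocalRing.le_maximalIdeal (Ideal.comap_ne_top _ hI.ne_top)
    have hJc : J.comap (algebraMap O C) = maximalIdeal O := by
      haveI := hJ
      exact IsLocalRing.eq_maximalIdeal (Ideal.isMaximal_comap_of_isIntegral_of_isMaximal (R := O) J)
    have hcJ : c ∈ J.comap (algebraMap O C) := hJc ▸ hIc hcI
    rw [Ideal.mem_comap, ← hxp] at hcJ
    exact hJ.isPrime.mem_of_pow_mem p hcJ
  obtain ⟨M, hM⟩ := Ideal.exists_maximal C
  exact IsLocalRing.of_unique_max_ideal ⟨M, hM, fun M' hM' => hM'.eq_of_le hM.ne_top (key M' M hM' hM)⟩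

end Literature.AlgebraicGeometry.Resolution

end
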